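import Mathlib
import Summits.Ventures.DiscreteObjects.Mahler.Height1CellSymmetry
import Summits.Ventures.DiscreteObjects.Mahler.CyclotomicFreeNegX

/-!
# Lifting an `xsym`-quotiented CORES certificate to the typed L6 statement (venture `DiscreteObjects`, target L)

Cell `pub-namedobj`, seat `pub-namedobj-mahler` (gen 7). Framing: lottery ticket; floor = certified
bounds/negative ranges.

The CORES run of family L6c enumerates height-1 polynomials of degree `56` modulo the symmetries
`P ↦ -P` and `P ↦ P(-x)` (`METHOD-L6c.md`: "xsym = 1: first nonzero odd coefficient > 0").  Its
certificate therefore states `CyclotomicFreeHeight1Degree56SubLehmerEmpty` only for CANONICAL `P`: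
positive leading coefficient and, among the odd-index coefficients `a₁, a₃, …`, the first nonzero one (if
any) positive.  This file proves that the canonical statement implies the full typed statement
(`cyclotomicFreeHeight1Degree56SubLehmerEmpty_of_canonical`, any degree: `cyclotomicFree_slice_lift`),
using the invariances of degree, height, Mahler measure and cyclotomic-freeness under the two
symmetries (`Height1CellSymmetry`, `CyclotomicFreeNegX`, `GraeffeIdentity`).  Conventions checked
against `code/mahler6/job_bundle60/censusL/engineB.py` (monic, "first nonzero odd-index coefficient
must be > 0"; for a RECIPROCAL `P` of even degree the ascending and descending coefficient sequences
coincide, so the index convention is immaterial; for an ANTIreciprocal family the sign flips —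
use `oddCanonical_or_comp_neg_X` with `P(-x)` in that case).
-/

namespace Summit.Ventures.DiscreteObjects.Mahler

open Polynomial

/-- Odd-index coefficients change sign under `x ↦ -x`. -/
theorem coeff_comp_neg_X_odd (P : ℤ[X]) (i : ℕ) :
    (P.comp (-X)).coeff (2 * i + 1) = -P.coeff (2 * i + 1) := by
  induction P using Polynomial.induction_on' with
  | add p q hp hq => simp only [add_comp, coeff_add, hp, hq]; ring
  | monomial n a =>
    rw [monomial_comp, coeff_monomial]
    have e : (C a * (-X) ^ n : ℤ[X]) = C (a * (-1) ^ n) * X ^ n := by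
      rw [neg_pow, C_mul, C_pow, C_neg, C_1]; ring
    rw [e, coeff_C_mul_X_pow]
    by_cases hni : 2 * i + 1 = n
    · subst hni
      rw [if_pos rfl, if_pos rfl, Odd.neg_one_pow ⟨i, rfl⟩]; ring
    · rw [if_neg hni, if_neg (Ne.symm hni), neg_zero]

/-- Either `P` or `P(-x)` has its first nonzero odd-index coefficient nonnegative (all later "first"
conditions being vacuous). -/
theorem oddCanonical_or_comp_neg_X (P : ℤ[X]) :
    (∀ k : ℕ, (∀ j < k, P.coeff (2 * j + 1) = 0) → 0 ≤ P.coeff (2 * k + 1)) ∨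
      (∀ k : ℕ, (∀ j < k, (P.comp (-X)).coeff (2 * j + 1) = 0) → 0 ≤ (P.comp (-X)).coeff (2 * k + 1)) := by
  by_cases h : ∀ k : ℕ, (∀ j < k, P.coeff (2 * j + 1) = 0) → 0 ≤ P.coeff (2 * k + 1)
  · exact Or.inl h
  · right
    push Not at h
    obtain ⟨k, hk, hneg⟩ := h
    intro k' hk'
    rcases lt_trichotomy k' k with hlt | rfl | hgt
    · rw [coeff_comp_neg_X_odd, hk k' hlt, neg_zero]
    · rw [coeff_comp_neg_X_odd]; omega
    · exfalso
      have := hk' k hgt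
      rw [coeff_comp_neg_X_odd] at this
      omega

/-- **Lift of a symmetry-quotiented slice certificate.**  If no CANONICAL integer polynomial of degree
`n`, height `≤ h`, cyclotomic-free, is sub-Lehmer — canonical meaning positive leading coefficient and
first nonzero odd-index coefficient positive — and `n` is even, then no such polynomial at all is
sub-Lehmer. -/
theorem cyclotomicFree_slice_lift {n h : ℕ} (hn : Even n)
    (H : ∀ P : ℤ[X], P.natDegree = n → height P ≤ h → 0 < P.leadingCoeff →
      (∀ k : ℕ, (∀ j < k, P.coeff (2 * j + 1) = 0) → 0 ≤ P.coeff (2 * k + 1)) →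
      (∀ m : ℕ, 0 < m → ¬ cyclotomic m ℤ ∣ P) → ¬ SubLehmer P) :
    ∀ P : ℤ[X], P.natDegree = n → height P ≤ h → (∀ m : ℕ, 0 < m → ¬ cyclotomic m ℤ ∣ P) →
      ¬ SubLehmer P := by
  -- step 1: positive leading coefficient, via `P ↦ -P`
  have step : ∀ P : ℤ[X], P.natDegree = n → height P ≤ h → 0 < P.leadingCoeff →
      (∀ m : ℕ, 0 < m → ¬ cyclotomic m ℤ ∣ P) → ¬ SubLehmer P := by
    intro P hdeg hh hlc hcf hsub
    rcases oddCanonical_or_comp_neg_X P with hcan | hcan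
    · exact H P hdeg hh hlc hcan hcf hsub
    · refine H (P.comp (-X)) ?_ ?_ ?_ hcan (cyclotomicFree_comp_neg_X hcf)
        ((subLehmer_comp_neg_X_iff P).mpr hsub)
      · rw [natDegree_comp, natDegree_neg, natDegree_X, mul_one, hdeg]
      · rw [height_comp_neg_X]; exact hh
      · rw [comp_neg_X_leadingCoeff_eq, hdeg, Even.neg_one_pow hn, one_mul]; exact hlc
  intro P hdeg hh hcf hsub
  have hP0 : P ≠ 0 := by
    rintro rfl
    have := hsub.1
    unfold intMahlerMeasure at this
    norm_num at this
  rcases lt_trichotomy 0 P.leadingCoeff with hpos | hzero | hneg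
  · exact step P hdeg hh hpos hcf hsub
  · exact hP0 (leadingCoeff_eq_zero.mp hzero.symm)
  · refine step (-P) (by rw [natDegree_neg, hdeg]) (by rw [height_neg]; exact hh) ?_ (cyclotomicFree_neg hcf) ?_
    · rw [leadingCoeff_neg]; omega
    · unfold SubLehmer at hsub ⊢; rw [intMahlerMeasure_neg]; exact hsub

/-- **The L6 CORES certificate, canonical form ⇒ typed form.** -/
theorem cyclotomicFreeHeight1Degree56SubLehmerEmpty_of_canonical
    (H : ∀ P : ℤ[X], P.natDegree = 56 → height P ≤ 1 → 0 < P.leadingCoeff →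
      (∀ k : ℕ, (∀ j < k, P.coeff (2 * j + 1) = 0) → 0 ≤ P.coeff (2 * k + 1)) →
      (∀ m : ℕ, 0 < m → ¬ cyclotomic m ℤ ∣ P) → ¬ SubLehmer P) :
    CyclotomicFreeHeight1Degree56SubLehmerEmpty :=
  cyclotomicFree_slice_lift (by norm_num) H

end Summit.Ventures.DiscreteObjects.Mahler
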